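import Summits.ResolutionOfSingularities.ResolutionOfSingularities.Theorems.AbsoluteQFrameIndep
import HarnessLib

/-!
# AbsoluteQFrameGeneration — decomp-res node «AbsoluteContactInsep» (lens-6 g18), tree file 6/10 of the node

Content VERBATIM from the decomp-res lens-6 g18 file `HOME/decomp-res-lens-6/g18/AbsoluteContactInsep.lean` (sha256
3771488be5d3cd2c, 1966 l; HOME =
run/shared/lean/pub/decomp-res).  Critic: CRITIC-LEDGER row 139 (CLEARED 2026-08-30T20:11:48Z, DECIDED +1:
`AbsContactOff3` proved for every p ≠ 3 and every
field, hypothesis-free); split per the lens's NODE-g18 §8 writer package (sections kept whole; two packages halved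
for the 400-line limit).  Landed by
decomp-res writer g7 in the lens's namespace `…Theorems.AbsoluteContactClasses` (cone-free chain); the wiring
`Theorems/MaxContactCutAbsContactOff3`
(`agAbsContactOff3 : AGAbsContactOff3`, item 27752) follows the chain.  No new aside, nothing superseded; asides
31574 / 27753 / 27896 are ⟺ each other
hypothesis-free by this node.

Sections `Generation` + `FrameAssembly` (l. 1128–1306).

[WRITER NOTE (decomp-res writer g7): file split only; namespace, opens, section variables and every declaration
exactly as in the lens (global `set_option` dropped).]

(Sources: Giraud1975; EGA IV 16.11.2, 0_IV 21.9; KimuraNiitsuma1980 Thm 3.4; EncinasVillamayor2000 Thm 4.9;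
BravoGarciaEscamillaVillamayor2012 Lemma 4.6; Hironaka1964; CossartJannsenSaito2020; CossartPiltant2019; Kunz1969.)
-/

noncomputable section

open CategoryTheory AlgebraicGeometry TopologicalSpace
open Literature.AlgebraicGeometry.Resolution
open Summit.ResolutionOfSingularities.ResolutionOfSingularities.Theorems
open WeakOrderReduction ForcedTowerClasses PurityValveClasses
open SatelliteExitClasses
open IsLocalRing MvPolynomial

namespace Summit.ResolutionOfSingularities.ResolutionOfSingularities.Theorems.AbsoluteContactClasses

section Generation

/-! ### B.3 Generation: `R = R^{p^e}[b][u]` (inverse trick, Nakayama over the subring, essential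
finiteness) and assembly of the frame -/

variable {R : Type*} [CommRing R] (p e : ℕ) [Fact p.Prime] [CharP R p] {ι : Type*} (b : ι → R)
  {d : ℕ} (u : Fin d → R)

/-- `Sq := R^{p^e}[b][u]`. -/
def genSubring : Subring R := Subring.closure ((frobSubring p e b : Set R) ∪ Set.range u)

/-- `frobSubring_le_genSubring`: Auxiliary step of this node's calculus, VERBATIM from the lens file (see the module
docstring); the statement is its type. [folklore] -/
theorem frobSubring_le_genSubring : frobSubring p e b ≤ genSubring p e b u :=
  fun _ hx => Subring.subset_closure (Or.inl hx)

/-- `pow_mem_genSubring`: Auxiliary step of this node's calculus, VERBATIM from the lens file (see the module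
docstring); the statement is its type. [folklore] -/
theorem pow_mem_genSubring (r : R) : r ^ p ^ e ∈ genSubring p e b u :=
  frobSubring_le_genSubring p e b u (pow_mem_frobSubring p e b r)

/-- `u_mem_genSubring`: Auxiliary step of this node's calculus, VERBATIM from the lens file (see the module
docstring); the statement is its type. [folklore] -/
theorem u_mem_genSubring (i : Fin d) : u i ∈ genSubring p e b u :=
  Subring.subset_closure (Or.inr ⟨i, rfl⟩)

/-- inverse trick: `y = y^{q} x^{q-1}` when `x y = 1`, so `Sq` is closed under existing inverses. [folklore] -/
theorem inv_mem_genSubring {x y : R} (hx : x ∈ genSubring p e b u) (hxy : x * y = 1) :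
    y ∈ genSubring p e b u := by
  have hq : 0 < p ^ e := pow_pos (Fact.out : p.Prime).pos e
  have key : y = y ^ p ^ e * x ^ (p ^ e - 1) := by
    have hx' : x ^ p ^ e = x * x ^ (p ^ e - 1) := by rw [← pow_succ', Nat.sub_add_cancel hq]
    have h1 : x * (y ^ p ^ e * x ^ (p ^ e - 1)) = 1 := by
      calc x * (y ^ p ^ e * x ^ (p ^ e - 1)) = (x * y) ^ p ^ e := by
            rw [mul_pow, hx']; ring
        _ = 1 := by rw [hxy, one_pow]
    calc y = y * (x * (y ^ p ^ e * x ^ (p ^ e - 1))) := by rw [h1, mul_one]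
      _ = (x * y) * (y ^ p ^ e * x ^ (p ^ e - 1)) := by ring
      _ = _ := by rw [hxy, one_mul]
  rw [key]
  exact mul_mem (pow_mem_genSubring p e b u y) (pow_mem hx _)

variable [IsLocalRing R]

/-- `𝔪 ∩ Sq` lies in the Jacobson radical of `Sq`. [folklore] -/
theorem comap_maximalIdeal_le_jacobson :
    Ideal.comap (genSubring p e b u).subtype (maximalIdeal R) ≤ (⊥ : Ideal (genSubring p e b u)).jacobson := by
  intro x hx
  rw [Ideal.mem_comap] at hx
  rw [Ideal.mem_jacobson_bot]
  intro y
  have hm : (x : R) * y ∈ maximalIdeal R := Ideal.mul_mem_right _ _ hx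
  have hunit : IsUnit ((x : R) * y + 1) := by
    by_contra h
    have h1 : (x : R) * y + 1 ∈ maximalIdeal R := (mem_maximalIdeal _).mpr (mem_nonunits_iff.mpr h)
    have : (1 : R) ∈ maximalIdeal R := by
      have := sub_mem h1 hm
      rwa [add_sub_cancel_left] at this
    exact (maximalIdeal.isMaximal R).ne_top ((Ideal.eq_top_iff_one _).mpr this)
  obtain ⟨w, hw⟩ := hunit.exists_right_inv
  have hwS : w ∈ genSubring p e b u := inv_mem_genSubring p e b u (x * y + 1).2 hw
  exact isUnit_iff_exists_inv.mpr ⟨⟨w, hwS⟩, Subtype.ext hw⟩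

/-- **Nakayama step**: if `R` is module-finite over `Sq` and `Sq → R/𝔪` is onto, then `R = Sq`
(`𝔪 = (u) ⊆ Sq · R`). [folklore] -/
theorem mem_genSubring_of_fg (hu : Ideal.span (Set.range u) = maximalIdeal R)
    (hfg : (⊤ : Submodule (genSubring p e b u) R).FG)
    (hres : ∀ x : R, ∃ s ∈ genSubring p e b u, x - s ∈ maximalIdeal R) (x : R) :
    x ∈ genSubring p e b u := by
  classical
  set Sq := genSubring p e b u with hSq
  have key : (⊤ : Submodule Sq R) ≤ Submodule.span Sq {(1 : R)} := by
    refine Submodule.le_of_le_smul_of_le_jacobson_bot hfg (comap_maximalIdeal_le_jacobson p e b u) ?_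
    intro y _
    obtain ⟨s, hs, hys⟩ := hres y
    rw [← hu, Ideal.mem_span_range_iff_exists_fun] at hys
    obtain ⟨c, hc⟩ := hys
    refine Submodule.mem_sup.mpr ⟨s, Submodule.mem_span_singleton.mpr ⟨⟨s, hs⟩, by
      rw [Subring.smul_def, smul_eq_mul, mul_one]⟩, y - s, ?_, add_sub_cancel s y⟩
    rw [← hc]
    refine Submodule.sum_mem _ fun i _ => ?_
    have : c i * u i = (⟨u i, u_mem_genSubring p e b u i⟩ : Sq) • c i := by
      rw [Subring.smul_def, smul_eq_mul, mul_comm]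
    rw [this]
    refine Submodule.smul_mem_smul ?_ Submodule.mem_top
    rw [Ideal.mem_comap, Subring.coe_subtype, ← hu]
    exact Ideal.subset_span ⟨i, rfl⟩
  have hx := key (Submodule.mem_top : x ∈ (⊤ : Submodule Sq R))
  obtain ⟨a, ha⟩ := Submodule.mem_span_singleton.mp hx
  rw [← ha, Subring.smul_def, smul_eq_mul, mul_one]
  exact a.2

omit [IsLocalRing R] in
open Pointwise in
/-- **Module-finiteness of `R` over `Sq`** from essential finiteness over a field `k` whose image
is finitely generated over `Sq` (digit splitting of monomials + the inverse trick). [folklore] -/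
theorem fg_top_genSubring (k : Type*) [Field k] [Algebra k R] [Algebra.EssFiniteType k R]
    (hk : ∃ Mk : Finset R, ∀ a : k, algebraMap k R a ∈ Submodule.span (genSubring p e b u) (Mk : Set R)) :
    (⊤ : Submodule (genSubring p e b u) R).FG := by
  classical
  have hq : 0 < p ^ e := pow_pos (Fact.out : p.Prime).pos e
  set Sq := genSubring p e b u with hSq
  obtain ⟨Mk, hMk⟩ := hk
  obtain ⟨σ, hσ⟩ := (Algebra.essFiniteType_iff k R).mp inferInstance
  -- the box monomials in the generators `σ`
  let σbox : Finset R :=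
    (Finset.univ : Finset (↥(σ : Set R) → Fin (p ^ e))).image fun f => ∏ s : ↥(σ : Set R), (s : R) ^ (f s : ℕ)
  let W : Submodule Sq R := Submodule.span Sq ((Mk : Set R) * (σbox : Set R))
  -- every element of `k[σ]` lies in `W`
  have hadj : ∀ a ∈ Algebra.adjoin k (σ : Set R), a ∈ W := by
    intro a ha
    rw [Algebra.adjoin_eq_range, AlgHom.mem_range] at ha
    obtain ⟨P, rfl⟩ := ha
    rw [P.as_sum, map_sum]
    refine Submodule.sum_mem _ fun ν _ => ?_
    rw [aeval_monomial]
    -- digit split of the monomial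
    have hsplit : (ν.prod fun (s : ↥(σ : Set R)) (k : ℕ) => (s : R) ^ k) =
        (∏ s : ↥(σ : Set R), (s : R) ^ (ν s / p ^ e)) ^ p ^ e * ∏ s : ↥(σ : Set R), (s : R) ^ (ν s % p ^ e) := by
      rw [Finsupp.prod_fintype _ _ (fun _ => pow_zero _), ← Finset.prod_pow, ← Finset.prod_mul_distrib]
      exact Finset.prod_congr rfl fun s _ => by rw [← pow_mul', ← pow_add, Nat.div_add_mod]
    have hmσ : (∏ s : ↥(σ : Set R), (s : R) ^ (ν s % p ^ e)) ∈ (σbox : Set R) := by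
      rw [Finset.mem_coe, Finset.mem_image]
      exact ⟨fun s => ⟨ν s % p ^ e, Nat.mod_lt _ hq⟩, Finset.mem_univ _, rfl⟩
    have hprod := Submodule.mul_mem_mul (hMk (coeff ν P)) (Submodule.subset_span (R := Sq) hmσ)
    rw [Submodule.span_mul_span] at hprod
    have : algebraMap k R (coeff ν P) * (ν.prod fun (s : ↥(σ : Set R)) (k : ℕ) => (s : R) ^ k) =
        (⟨(∏ s : ↥(σ : Set R), (s : R) ^ (ν s / p ^ e)) ^ p ^ e, pow_mem_genSubring p e b u _⟩ : Sq) •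
          (algebraMap k R (coeff ν P) * ∏ s : ↥(σ : Set R), (s : R) ^ (ν s % p ^ e)) := by
      rw [hsplit, Subring.smul_def, smul_eq_mul]; simp only; ring
    rw [this]
    exact Submodule.smul_mem _ _ hprod
  refine ⟨Mk * σbox, ?_⟩
  rw [Finset.coe_mul]
  refine eq_top_iff.mpr fun x _ => ?_
  obtain ⟨t, htA, htu, hxt⟩ := hσ x
  obtain ⟨w, hw⟩ := htu.exists_right_inv
  have ht : t ^ p ^ e = t * t ^ (p ^ e - 1) := by rw [← pow_succ', Nat.sub_add_cancel hq]
  have hx : x = (⟨w ^ p ^ e, pow_mem_genSubring p e b u w⟩ : Sq) • (x * t * t ^ (p ^ e - 1)) := by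
    rw [Subring.smul_def, smul_eq_mul]; simp only
    calc x = x * (t * w) ^ p ^ e := by rw [hw, one_pow, mul_one]
      _ = w ^ p ^ e * (x * t * t ^ (p ^ e - 1)) := by rw [mul_pow, ht]; ring
  rw [hx]
  exact Submodule.smul_mem _ _ (hadj _ (Subalgebra.mul_mem _ hxt (Subalgebra.pow_mem _ htA _)))

end Generation

section FrameAssembly

variable {R : Type*} [CommRing R] [IsRegularLocalRing R] (p e : ℕ) [Fact p.Prime] [CharP R p] {ι : Type*}
  (b : ι → R) {d : ℕ} (hd : (maximalIdeal R).spanFinrank = d) (u : Fin d → R)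
  (hu : Ideal.span (Set.range u) = maximalIdeal R)

include hd hu

/-- **Assembly of the absolute `p^e`-frame** `Cq = R^{p^e}[b]` from: `p^e`-independence of the
residues `b̄` (linear form), generation of the residue field by `K^{p^e}` and `b̄`, and finite
generation of the coefficient field `k` over `Sq = Cq[u]`. [folklore] -/
theorem isQFrame_frobSubring (k : Type*) [Field k] [Algebra k R] [Algebra.EssFiniteType k R]
    (hT : QIndep (p ^ e) (fun i => residue R (b i)))
    (hK : ∀ ξ : ResidueField R, ξ ∈ Subring.closure
      ((fun y : ResidueField R => y ^ p ^ e) '' Set.univ ∪ Set.range (fun i => residue R (b i))))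
    (hk : ∃ Mk : Finset R, ∀ a : k, algebraMap k R a ∈ Submodule.span (genSubring p e b u) (Mk : Set R)) :
    IsQFrame (p ^ e) (frobSubring p e b) u where
  pow_mem := pow_mem_frobSubring p e b
  linearIndependent := linearIndependent_boxMon p e b hd u hu hT
  top_le_span := by
    have hq : 0 < p ^ e := pow_pos (Fact.out : p.Prime).pos e
    refine top_le_span_boxMon hq _ u (fun i => pow_mem_frobSubring p e b (u i)) fun x => ?_
    have hres : ∀ x : R, ∃ s ∈ genSubring p e b u, x - s ∈ maximalIdeal R := by
      intro x
      have hsub : Subring.closure ((fun y : ResidueField R => y ^ p ^ e) '' Set.univ ∪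
          Set.range (fun i => residue R (b i))) ≤ (genSubring p e b u).map (residue R) := by
        rw [Subring.closure_le]
        rintro ξ (⟨y, -, rfl⟩ | ⟨i, rfl⟩)
        · obtain ⟨z, rfl⟩ := residue_surjective y
          exact ⟨z ^ p ^ e, pow_mem_genSubring p e b u z, by rw [map_pow]⟩
        · exact ⟨b i, frobSubring_le_genSubring p e b u (apply_mem_frobSubring p e b i), rfl⟩
      obtain ⟨s, hs, hsx⟩ := hsub (hK (residue R x))
      refine ⟨s, hs, ?_⟩
      rw [← residue_eq_zero_iff, map_sub, hsx, sub_self]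
    exact mem_genSubring_of_fg p e b u hu (fg_top_genSubring p e b u k hk) hres x

end FrameAssembly

end Summit.ResolutionOfSingularities.ResolutionOfSingularities.Theorems.AbsoluteContactClasses
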